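import Summits.QuantumFields.YangMills.Theorems.AtomicCalibrationRBandPiece
import Summits.QuantumFields.YangMills.Theorems.AtomicCalibrationRPieceUniform
import Summits.QuantumFields.YangMills.Theorems.AtomicCalibrationRGevreyLeibniz

/-!
# AtomicCalibrationR (stmt-QuantumFields-28169), E2 `stub_offDiagonalWhitney` — clause (v) for band pieces with factorial (Gevrey) rates
# (roadmap v3 item G.3, re-threading of `BandPiece` / `PieceUniform`; prover w4 g22, free hands)

Same statements as `BandPiece.norm_iteratedFDeriv_bandPiece_le` and `PieceUniform.norm_iteratedFDeriv_bandPiece_uniform_le`, but the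
bump part `b = (pairCut (k+1) − pairCut k)·g` is only assumed to have FACTORIAL rates `‖D^i b(z)‖ ≤ (i!)^s R^i` (as delivered by
`GevreyBandBump` with budget-free constants); the conclusion picks up exactly one factor `(m!)^s`:

* `norm_iteratedFDeriv_bandPiece_le_factorial` — `‖D^m (G b)(z)‖ ≤ (m!)^s (2^M 2^{k'}‖F‖_M/(1+‖z‖)^{k'}) (1+2^{−k}R)^m (2^{−k})^K R^m`;
* `norm_iteratedFDeriv_bandPiece_uniform_le_factorial` — the z-uniform `M/ρ^m` form on the cube of `gridBump φ n h c`.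

No stub/crux/rung/summit is closed; nothing here touches Yang–Mills; the YM mass gap is NOT proved. [folklore]
-/

set_option autoImplicit false

noncomputable section

open scoped BigOperators ContDiff Topology
open Set Metric Filter Function
open Summit.QuantumFields.YangMills.Cruxes.AtomicCalibrationR.PairCutoff (pairCut contDiff_pairCut)
open Summit.QuantumFields.YangMills.Cruxes.AtomicCalibrationR.GridPartition (gridBump gridCentre tsupport_gridBump_subset)
open Summit.QuantumFields.YangMills.Cruxes.AtomicCalibrationR.BandPiece (norm_iteratedFDeriv_le_schwartzNorm_of_mem_closedBall
  isOpen_far pairCut_succ_sub_eq_zero_of_far)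
open Summit.QuantumFields.YangMills.Cruxes.AtomicCalibrationR.PieceUniform (one_add_norm_centre_le)
open Summit.QuantumFields.YangMills.Cruxes.AtomicCalibrationR.GevreyLeibniz (norm_iteratedFDeriv_mul_le_of_flat_factorial')
open Literature.MathematicalPhysics.QuantumLattice (schwartzNorm schwartzNorm_nonneg)
open Literature.MathematicalPhysics.AQFT (IsOffDiagonal)

namespace Summit.QuantumFields.YangMills.Cruxes.AtomicCalibrationR.GevreyBandPiece

variable {n : ℕ}

/-- **Clause (v) for band pieces, factorial rates.** [folklore] -/
theorem norm_iteratedFDeriv_bandPiece_le_factorial (F : SchwartzMap (Fin n → EuclideanSpace ℝ (Fin 4)) ℂ)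
    (hF : IsOffDiagonal F) {G : (Fin n → EuclideanSpace ℝ (Fin 4)) → ℝ} (hG : ContDiff ℝ ∞ G)
    (hGF : ∀ (j : ℕ) (w : Fin n → EuclideanSpace ℝ (Fin 4)), ‖iteratedFDeriv ℝ j G w‖ ≤ ‖iteratedFDeriv ℝ j F w‖)
    {g : (Fin n → EuclideanSpace ℝ (Fin 4)) → ℝ} (hg : ContDiff ℝ ∞ g) (k : ℕ) {K m k' : ℕ} (hmK : m < K) (s : ℕ)
    {R : ℝ} (hR : (2 : ℝ) ^ (k + 2) ≤ R) (z : Fin n → EuclideanSpace ℝ (Fin 4))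
    (hb : ∀ i : ℕ, i ≤ m → ‖iteratedFDeriv ℝ i (fun w => (pairCut n (k + 1) w - pairCut n k w) * g w) z‖ ≤
      ((Nat.factorial i : ℕ) : ℝ) ^ s * R ^ i) :
    ‖iteratedFDeriv ℝ m (fun w => G w * ((pairCut n (k + 1) w - pairCut n k w) * g w)) z‖ ≤
      ((Nat.factorial m : ℕ) : ℝ) ^ s * ((2 ^ max k' K * 2 ^ k' * schwartzNorm (max k' K) F / (1 + ‖z‖) ^ k') *
        (1 + (2 : ℝ)⁻¹ ^ k * R) ^ m * ((2 : ℝ)⁻¹ ^ k) ^ K * R ^ m) := by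
  set r : ℝ := (2 : ℝ)⁻¹ ^ k with hr
  set P : ℝ := 2 ^ max k' K * 2 ^ k' * schwartzNorm (max k' K) F / (1 + ‖z‖) ^ k' with hP
  have hr0 : 0 < r := by positivity
  have hRpos : 0 < R := lt_of_lt_of_le (by positivity) hR
  have hP0 : 0 ≤ P := by have := schwartzNorm_nonneg (max k' K) F; positivity
  have hRHS0 : 0 ≤ ((Nat.factorial m : ℕ) : ℝ) ^ s * (P * (1 + r * R) ^ m * r ^ K * R ^ m) := by positivity
  have hb_smooth : ContDiff ℝ ∞ (fun w => (pairCut n (k + 1) w - pairCut n k w) * g w) :=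
    ((contDiff_pairCut n (k + 1)).sub (contDiff_pairCut n k)).mul hg
  by_cases hnear : ∃ l l' : Fin n, l ≠ l' ∧ ‖z l - z l'‖ ≤ 2 * (2 : ℝ)⁻¹ ^ k
  · obtain ⟨l, l', hll', hd⟩ := hnear
    set ρ' : ℝ := ‖z l - z l'‖ / 2 with hρ'
    have hρ'0 : 0 ≤ ρ' := by positivity
    have hρ'r : ρ' ≤ r := by rw [hρ', hr]; linarith
    have hr1 : r ≤ 1 := by rw [hr]; exact pow_le_one₀ (by norm_num) (by norm_num)
    have hB : ∀ w ∈ closedBall z ρ', ‖iteratedFDeriv ℝ K F w‖ ≤ P := by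
      intro w hw
      refine (norm_iteratedFDeriv_le_schwartzNorm_of_mem_closedBall F k' K hρ'0 hw).trans ?_
      rw [hP]
      have hS : 0 ≤ schwartzNorm (max k' K) F := schwartzNorm_nonneg _ _
      refine div_le_div_of_nonneg_right ?_ (by positivity)
      refine mul_le_mul_of_nonneg_right (mul_le_mul_of_nonneg_left ?_ (by positivity)) hS
      exact pow_le_pow_left₀ (by positivity) (by linarith) k'
    have hFb : ∀ j : ℕ, j ≤ m → ‖iteratedFDeriv ℝ j G z‖ ≤ P * r ^ (K - j) := by
      intro j hj
      have hjK : j < K := lt_of_le_of_lt hj hmK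
      have h1 := hF.norm_iteratedFDeriv_le_of_pair_local hll' hjK z hB
      refine (hGF j z).trans (h1.trans ?_)
      have hfac : (1 : ℝ) ≤ (K - j - 1).factorial := by
        exact_mod_cast Nat.one_le_iff_ne_zero.2 (Nat.factorial_ne_zero _)
      calc P * (‖z l - z l'‖ / 2) ^ (K - j) / (K - j - 1).factorial ≤ P * (‖z l - z l'‖ / 2) ^ (K - j) :=
            div_le_self (by positivity) hfac
        _ ≤ P * r ^ (K - j) := mul_le_mul_of_nonneg_left (pow_le_pow_left₀ hρ'0 hρ'r _) hP0
    have hΦb : ∀ i : ℕ, i ≤ m → ‖iteratedFDeriv ℝ i (fun w => (pairCut n (k + 1) w - pairCut n k w) * g w) z‖ ≤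
        1 * ((Nat.factorial i : ℕ) : ℝ) ^ s * R⁻¹⁻¹ ^ i := by
      intro i hi; rw [inv_inv, one_mul]; exact hb i hi
    have hsr : R⁻¹ ≤ r := by
      rw [hr, inv_pow, inv_le_inv₀ hRpos (by positivity)]
      calc (2 : ℝ) ^ k ≤ 2 ^ (k + 2) := pow_le_pow_right₀ (by norm_num) (by omega)
        _ ≤ R := hR
    have h := norm_iteratedFDeriv_mul_le_of_flat_factorial' (A := ℝ) hG hb_smooth hmK.le hP0 zero_le_one (inv_pos.2 hRpos)
      hsr s z hFb hΦb
    refine h.trans (le_of_eq ?_)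
    rw [div_eq_mul_inv, ← inv_pow, inv_inv, div_eq_mul_inv, inv_inv]
    ring
  · push Not at hnear
    have hfar : ∀ l l' : Fin n, l ≠ l' → 2 * (2 : ℝ)⁻¹ ^ k < ‖z l - z l'‖ := fun l l' hll' => hnear l l' hll'
    have hev : (fun w => G w * ((pairCut n (k + 1) w - pairCut n k w) * g w)) =ᶠ[𝓝 z] fun _ => (0 : ℝ) := by
      filter_upwards [(isOpen_far n k).mem_nhds hfar] with w hw
      rw [pairCut_succ_sub_eq_zero_of_far hw, zero_mul, mul_zero]
    rw [(hev.iteratedFDeriv ℝ m).eq_of_nhds, iteratedFDeriv_fun_zero, Pi.zero_apply, norm_zero]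
    exact hRHS0

/-- **Clause (v), uniform form, band pieces, factorial rates.** [folklore] -/
theorem norm_iteratedFDeriv_bandPiece_uniform_le_factorial (F : SchwartzMap (Fin n → EuclideanSpace ℝ (Fin 4)) ℂ)
    (hF : IsOffDiagonal F) {G : (Fin n → EuclideanSpace ℝ (Fin 4)) → ℝ} (hG : ContDiff ℝ ∞ G)
    (hGF : ∀ (j : ℕ) (w : Fin n → EuclideanSpace ℝ (Fin 4)), ‖iteratedFDeriv ℝ j G w‖ ≤ ‖iteratedFDeriv ℝ j F w‖)
    {φ : ℝ → ℝ} (hφ : ContDiff ℝ ∞ φ) (hφs : tsupport φ ⊆ Icc (-1 : ℝ) 1) {h : ℝ} (hh : 0 < h) (hh2 : 2 * h ≤ 1 / 2)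
    (c : Fin n × Fin 4 → ℤ) (k : ℕ) {K m k' : ℕ} (hmK : m < K) (s : ℕ) {R : ℝ} (hR : (2 : ℝ) ^ (k + 2) ≤ R)
    (hb : ∀ (z : Fin n → EuclideanSpace ℝ (Fin 4)) (i : ℕ), i ≤ m →
      ‖iteratedFDeriv ℝ i (fun w => (pairCut n (k + 1) w - pairCut n k w) * gridBump φ n h c w) z‖ ≤
        ((Nat.factorial i : ℕ) : ℝ) ^ s * R ^ i)
    (z : Fin n → EuclideanSpace ℝ (Fin 4)) :
    ‖iteratedFDeriv ℝ m (fun w => G w * ((pairCut n (k + 1) w - pairCut n k w) * gridBump φ n h c w)) z‖ ≤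
      ((Nat.factorial m : ℕ) : ℝ) ^ s *
        (2 ^ max k' K * 4 ^ k' * schwartzNorm (max k' K) F / (1 + ‖gridCentre n h c‖) ^ k' *
          (1 + (2 : ℝ)⁻¹ ^ k * R) ^ m * ((2 : ℝ)⁻¹ ^ k) ^ K * (2 * h * R) ^ m) / (2 * h) ^ m := by
  have hRpos : 0 < R := lt_of_lt_of_le (by positivity) hR
  have hS : 0 ≤ schwartzNorm (max k' K) F := schwartzNorm_nonneg _ _
  have h2h : 0 < 2 * h := by linarith
  have hRHS : 0 ≤ ((Nat.factorial m : ℕ) : ℝ) ^ s *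
      (2 ^ max k' K * 4 ^ k' * schwartzNorm (max k' K) F / (1 + ‖gridCentre n h c‖) ^ k' *
        (1 + (2 : ℝ)⁻¹ ^ k * R) ^ m * ((2 : ℝ)⁻¹ ^ k) ^ K * (2 * h * R) ^ m) / (2 * h) ^ m := by positivity
  by_cases hz : z ∈ tsupport (fun w => G w * ((pairCut n (k + 1) w - pairCut n k w) * gridBump φ n h c w))
  · have hcube : ∀ l, ‖z l - gridCentre n h c l‖ ≤ 2 * h := by
      have hsub : tsupport (fun w => G w * ((pairCut n (k + 1) w - pairCut n k w) * gridBump φ n h c w)) ⊆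
          tsupport (gridBump φ n h c) :=
        (tsupport_mul_subset_right
          (f := fun w => G w) (g := fun w => (pairCut n (k + 1) w - pairCut n k w) * gridBump φ n h c w)).trans
          (tsupport_mul_subset_right (f := fun w => pairCut n (k + 1) w - pairCut n k w) (g := gridBump φ n h c))
      exact tsupport_gridBump_subset hφs n hh c (hsub hz)
    have hcmp := one_add_norm_centre_le hh hh2 c hcube
    have h1 := norm_iteratedFDeriv_bandPiece_le_factorial F hF hG hGF
      (Summit.QuantumFields.YangMills.Cruxes.AtomicCalibrationR.GridPartition.contDiff_gridBump hφ n h c) k (k' := k') hmK s hR z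
      (hb z)
    refine h1.trans ?_
    have hdec : 2 ^ max k' K * 2 ^ k' * schwartzNorm (max k' K) F / (1 + ‖z‖) ^ k' ≤
        2 ^ max k' K * 4 ^ k' * schwartzNorm (max k' K) F / (1 + ‖gridCentre n h c‖) ^ k' := by
      rw [div_le_div_iff₀ (by positivity) (by positivity)]
      have hpow : (1 + ‖gridCentre n h c‖) ^ k' ≤ 2 ^ k' * (1 + ‖z‖) ^ k' := by
        rw [← mul_pow]; exact pow_le_pow_left₀ (by positivity) hcmp k'
      have h4 : (4 : ℝ) ^ k' = 2 ^ k' * 2 ^ k' := by rw [← mul_pow]; norm_num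
      calc 2 ^ max k' K * 2 ^ k' * schwartzNorm (max k' K) F * (1 + ‖gridCentre n h c‖) ^ k'
          ≤ 2 ^ max k' K * 2 ^ k' * schwartzNorm (max k' K) F * (2 ^ k' * (1 + ‖z‖) ^ k') :=
            mul_le_mul_of_nonneg_left hpow (by positivity)
        _ = 2 ^ max k' K * 4 ^ k' * schwartzNorm (max k' K) F * (1 + ‖z‖) ^ k' := by rw [h4]; ring
    have hRm : R ^ m = (2 * h * R) ^ m / (2 * h) ^ m := by
      rw [mul_pow, mul_comm, mul_div_assoc, div_self (pow_ne_zero _ h2h.ne'), mul_one]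
    rw [hRm]
    have hmid : 0 ≤ (1 + (2 : ℝ)⁻¹ ^ k * R) ^ m * ((2 : ℝ)⁻¹ ^ k) ^ K := by positivity
    have hq : 0 ≤ (2 * h * R) ^ m / (2 * h) ^ m := by positivity
    have hfac0 : 0 ≤ ((Nat.factorial m : ℕ) : ℝ) ^ s := by positivity
    have hkey := mul_le_mul_of_nonneg_right (mul_le_mul_of_nonneg_right hdec hmid) hq
    calc ((Nat.factorial m : ℕ) : ℝ) ^ s * (2 ^ max k' K * 2 ^ k' * schwartzNorm (max k' K) F / (1 + ‖z‖) ^ k' *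
          (1 + (2 : ℝ)⁻¹ ^ k * R) ^ m * ((2 : ℝ)⁻¹ ^ k) ^ K * ((2 * h * R) ^ m / (2 * h) ^ m))
        = ((Nat.factorial m : ℕ) : ℝ) ^ s * (2 ^ max k' K * 2 ^ k' * schwartzNorm (max k' K) F / (1 + ‖z‖) ^ k' *
          ((1 + (2 : ℝ)⁻¹ ^ k * R) ^ m * ((2 : ℝ)⁻¹ ^ k) ^ K) * ((2 * h * R) ^ m / (2 * h) ^ m)) := by ring
      _ ≤ ((Nat.factorial m : ℕ) : ℝ) ^ s * (2 ^ max k' K * 4 ^ k' * schwartzNorm (max k' K) F /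
          (1 + ‖gridCentre n h c‖) ^ k' * ((1 + (2 : ℝ)⁻¹ ^ k * R) ^ m * ((2 : ℝ)⁻¹ ^ k) ^ K) *
          ((2 * h * R) ^ m / (2 * h) ^ m)) := mul_le_mul_of_nonneg_left hkey hfac0
      _ = _ := by ring
  · have h0 : iteratedFDeriv ℝ m (fun w => G w * ((pairCut n (k + 1) w - pairCut n k w) * gridBump φ n h c w)) z = 0 := by
      by_contra hne
      exact hz (support_iteratedFDeriv_subset m (mem_support.2 hne))
    rw [h0, norm_zero]
    exact hRHS

end Summit.QuantumFields.YangMills.Cruxes.AtomicCalibrationR.GevreyBandPiece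

end
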